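import Summits.HubbardSuperconductivity.HubbardSuperconductivity.Theorems.AnisotropyChordStiffnessDefs

/-!
# Route `AnisotropyChord` / H0 rotor rung: H1′ — GAUSSIAN COMPARABILITY of the insertion entropy and the PROVED
# link `H1′ ∧ (IR_α) ∧ (S ≤ S_max) ⇒ E` (theory seat memo ROTOR-THEORY-8 §117; Sketch8 Part M ported)

* `gaussianInsertionEntropy L aM aN P_M x = Σ_{k≠0} |δρ̂_x(k)|²/(2 P_M S_M(k))` — the two-point (linear-response)
  value of the insertion entropy (ED: KL_G/KL = 0.91–0.96, memo §117);
* `GaussianInsertionComparison Δ M` (H1′, typed; OPEN): `KL(ν_x‖π) ≤ C·KL_G(x) + C′` eventually;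
* `gaussianInsertionEntropy_le` — finite-volume bound from `|δρ̂| ≤ B` and `(IR_α)`;
* **`insertionEntropyBound_of_gaussianComparison`** — `H1′ ∧ (IR_α) ∧ (S ≤ S_max) ⇒ E` along a density sequence
  (over the tree's `norm_kernelFT_insertionResponse_le`, `exists_sum_rpow_neg_torusNorm_le`, `tendsto_density_pred`);
* **`eventualCondensate_of_twistStiffness_gaussian`** — TWIST-IR ⇒ ((S_tw) ∧ H1′ ∧ (S ≤ S_max) ⇒ BEC), the cycle-8
  form of the target.
Typing authority: theory seat `hubbard-h0-rotor-theory-1`, cycle 8.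
-/

set_option linter.dupNamespace false

noncomputable section

open Matrix Complex Finset Filter Topology
open scoped ComplexConjugate
open Literature.MathematicalPhysics.QuantumLattice hiding torusPhase torusNorm
open Literature.Probability.LatticeModels
open Summit.HubbardSuperconductivity.HubbardSuperconductivity.Theorems.AnisotropyChord.Stiffness
  (TwistStiffnessInfrared UniformTwistStiffness infraredStructureBound_of_uniformTwistStiffness)

namespace Summit.HubbardSuperconductivity.HubbardSuperconductivity.Theorems.AnisotropyChord.InsertionEntropy


/-- The GAUSSIAN (two-point) insertion entropy at `x`:
`KL_G(x) := Σ_{k ≠ 0} |δρ̂_x(k)|² / (2 P_M S_M(k))` (`= |Λ|⁻¹ Σ_{k≠0} |δρ̂_x(k)|²/(2ρ_b S_M(k))`, the value of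
`KL(ν_x ‖ π)` when `log(ν_x/π)` is linear in the density with the linear-response kernel; memo §117:
KL_G / KL = 0.91–0.96 in ED).  A functional of TWO-POINT data only. [folklore] -/
def gaussianInsertionEntropy (L : ℕ) [NeZero L] (aM aN : TensorIndex (TorusSite 2 L) 2 → ℝ) (PM : ℝ)
    (x : TorusSite 2 L) : ℝ :=
  ∑ k ∈ Finset.univ.filter (fun k : TorusSite 2 L => k ≠ 0),
    ‖kernelFT L (insertionResponse aM aN x) k‖ ^ 2 / (2 * PM * structureFactor L aM PM k)

/-- **HYPOTHESIS H1′ — `GaussianInsertionComparison` (memo §117; replaces H1 as the condensation-side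
input).**  Eventually in `L`, for all adjacent Perron pairs and sites `x`: `ν_x ≪ π` and
`KL(ν_x ‖ π) ≤ C · KL_G(x) + C'` — the insertion entropy is comparable to its Gaussian (two-point) value.
ED (§117): KL/KL_G = 1.04–1.10 (6×6…8×8, Δ = 0, ½).  Physically: infrared Gaussianity of the superfluid
(beyond-Bogoliubov vertices irrelevant); exact in the harmonic-fluid description. [conjecture: theory seat hubbard-h0-rotor-theory-1, cycle 8, 2026-08-28 — memo ROTOR-THEORY-8 §117 (OPEN)] -/
def GaussianInsertionComparison (Δ : ℝ) (M : ℕ → ℝ) : Prop :=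
  ∃ C C' : ℝ, ∀ᶠ L : ℕ in atTop, ∀ [NeZero L],
    ∀ aN aM : TensorIndex (TorusSite 2 L) 2 → ℝ,
      IsPerronSectorGroundAmplitude L Δ (M L) aN → IsPerronSectorGroundAmplitude L Δ (M L - 1) aM →
        ∀ x : TorusSite 2 L,
          (∀ τ, 0 < holeLaw aN x τ → 0 < bornLaw aM τ) ∧
          klDiv (holeLaw aN x) (bornLaw aM)
            ≤ C * gaussianInsertionEntropy L aM aN ((L : ℝ) ^ 2 / 2 + (M L - 1)) x + C'

/-- **Finite-volume bound on `KL_G`:** if `|δρ̂_x(k)| ≤ B` and `S_M(k) ≥ c|k|_T^α` (`k ≠ 0`, `c > 0`,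
`P_M > 0`) then `KL_G(x) ≤ (B²/(2 c P_M)) Σ_{k≠0} |k|_T^{−α}`. [folklore] -/
theorem gaussianInsertionEntropy_le {L : ℕ} [NeZero L] (aM aN : TensorIndex (TorusSite 2 L) 2 → ℝ)
    (PM : ℝ) (hPM : 0 < PM) (x : TorusSite 2 L) (B c α : ℝ) (hc : 0 < c)
    (hresp : ∀ k : TorusSite 2 L, k ≠ 0 → ‖kernelFT L (insertionResponse aM aN x) k‖ ≤ B)
    (hIR : ∀ k : TorusSite 2 L, k ≠ 0 → c * (torusNorm L k) ^ α ≤ structureFactor L aM PM k) :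
    gaussianInsertionEntropy L aM aN PM x
      ≤ B ^ 2 / (2 * c * PM) *
          ∑ k ∈ Finset.univ.filter (fun k : TorusSite 2 L => k ≠ 0), (torusNorm L k) ^ (-α) := by
  unfold gaussianInsertionEntropy
  rw [Finset.mul_sum]
  refine Finset.sum_le_sum fun k hk => ?_
  have hk0 : k ≠ 0 := (Finset.mem_filter.mp hk).2
  have hnk : 0 < torusNorm L k := torusNorm_pos hk0
  have hpow : 0 < (torusNorm L k) ^ α := Real.rpow_pos_of_pos hnk α
  have hB : ‖kernelFT L (insertionResponse aM aN x) k‖ ≤ B := hresp k hk0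
  have hB0 : 0 ≤ B := (norm_nonneg _).trans hB
  have hden : 0 < 2 * PM * (c * (torusNorm L k) ^ α) := by positivity
  calc ‖kernelFT L (insertionResponse aM aN x) k‖ ^ 2 / (2 * PM * structureFactor L aM PM k)
      ≤ B ^ 2 / (2 * PM * structureFactor L aM PM k) := by
        refine div_le_div_of_nonneg_right ?_ ?_
        · exact pow_le_pow_left₀ (norm_nonneg _) hB 2
        · exact le_of_lt (lt_of_lt_of_le hden (by nlinarith [hIR k hk0, hPM.le]))
    _ ≤ B ^ 2 / (2 * PM * (c * (torusNorm L k) ^ α)) := by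
        refine div_le_div_of_nonneg_left (by positivity) hden ?_
        exact mul_le_mul_of_nonneg_left (hIR k hk0) (by positivity)
    _ = B ^ 2 / (2 * c * PM) * (torusNorm L k) ^ (-α) := by
        rw [Real.rpow_neg hnk.le]
        field_simp

/-- **THE LINK `H1′ ∧ (IR_α) ∧ (S ≤ S_max) ⇒ E` (PROVED):** along every sector sequence of density
`1/2 + M_L/L² → ρ ∈ (0,1)`, Gaussian comparability of the insertion entropy, the infrared structure bound
and the upper structure bound give Conjecture E (`InsertionEntropyBound`).  With TWIST-IR (Part F) this
makes the conditional theorem «uniform twist stiffness ∧ H1′ ∧ (S ≤ S_max) ⇒ BEC» (next theorem). [folklore] -/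
theorem insertionEntropyBound_of_gaussianComparison (Δ : ℝ) (M : ℕ → ℝ) (ρ : ℝ)
    (hρ : ρ ∈ Set.Ioo (0 : ℝ) 1)
    (hlim : Tendsto (fun L : ℕ => 1 / 2 + M L / (L : ℝ) ^ 2) atTop (nhds ρ))
    (hG : GaussianInsertionComparison Δ M) (hIR : InfraredStructureBound Δ M)
    (hS : StructureFactorUpper Δ M) : InsertionEntropyBound Δ M := by
  obtain ⟨C, C', hG⟩ := hG
  obtain ⟨c, hc, α, hα, hIR⟩ := hIR
  obtain ⟨Smax, hS⟩ := hS
  obtain ⟨Clat, hClat0, hClat⟩ := exists_sum_rpow_neg_torusNorm_le hα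
  have hρ0 : 0 < ρ := hρ.1
  have hρ1 : ρ < 1 := hρ.2
  have hlimM := tendsto_density_pred M ρ hlim
  have hN : ∀ᶠ L : ℕ in atTop, ρ / 2 ≤ 1 / 2 + M L / (L : ℝ) ^ 2 :=
    hlim.eventually (eventually_ge_nhds (by linarith))
  have hMlo : ∀ᶠ L : ℕ in atTop, ρ / 2 ≤ 1 / 2 + (M L - 1) / (L : ℝ) ^ 2 :=
    hlimM.eventually (eventually_ge_nhds (by linarith))
  have hMhi : ∀ᶠ L : ℕ in atTop, 1 / 2 + (M L - 1) / (L : ℝ) ^ 2 ≤ (1 + ρ) / 2 :=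
    hlimM.eventually (eventually_le_nhds (by linarith))
  set Cp : ℝ := max C 0 with hCp
  set Smax' : ℝ := max Smax 0 with hSmax'
  set B : ℝ := Smax' + 1 + Smax' / (1 - (1 + ρ) / 2) with hB
  have h1ρ : 0 < 1 - (1 + ρ) / 2 := by linarith
  have hB0 : 0 ≤ B := by rw [hB]; positivity
  refine ⟨Cp * (B ^ 2 / (2 * c * (ρ / 2)) * Clat) + C', ?_⟩
  filter_upwards [hG, hIR, hS, hN, hMlo, hMhi] with L hGL hIRL hSL hNL hMloL hMhiL
  intro _ aN aM haN haM x
  obtain ⟨hac, hKL⟩ := hGL aN aM haN haM x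
  refine ⟨hac, ?_⟩
  have hL : (0 : ℝ) < (L : ℝ) ^ 2 := by
    have : (0 : ℝ) < (L : ℝ) := by exact_mod_cast Nat.pos_of_ne_zero (NeZero.ne L)
    positivity
  have hL' : (L : ℝ) ≠ 0 := by exact_mod_cast (NeZero.ne L)
  have hρN : 0 < 1 / 2 + M L / (L : ℝ) ^ 2 := lt_of_lt_of_le (by linarith) hNL
  have hρM0 : 0 < 1 / 2 + (M L - 1) / (L : ℝ) ^ 2 := lt_of_lt_of_le (by linarith) hMloL
  have hρM1 : 1 / 2 + (M L - 1) / (L : ℝ) ^ 2 < 1 := lt_of_le_of_lt hMhiL (by linarith)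
  have hPN : (L : ℝ) ^ 2 / 2 + M L = (L : ℝ) ^ 2 * (1 / 2 + M L / (L : ℝ) ^ 2) := by field_simp
  have hPM : (L : ℝ) ^ 2 / 2 + (M L - 1) = (L : ℝ) ^ 2 * (1 / 2 + (M L - 1) / (L : ℝ) ^ 2) := by
    field_simp
  have hPM0 : 0 < (L : ℝ) ^ 2 / 2 + (M L - 1) := by rw [hPM]; positivity
  -- densities, translation invariance, the response bound `B`
  have hdN : ∀ s, siteDensity aN s = 1 / 2 + M L / (L : ℝ) ^ 2 :=
    fun s => siteDensity_eq_of_isPerron L Δ (M L) aN haN s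
  have hdM : ∀ s, siteDensity aM s = 1 / 2 + (M L - 1) / (L : ℝ) ^ 2 :=
    fun s => siteDensity_eq_of_isPerron L Δ (M L - 1) aM haM s
  have hbN := perronAmplitude_shiftConfig Δ (M L) aN haN
  have hbM := perronAmplitude_shiftConfig Δ (M L - 1) aM haM
  have hSmax0 : 0 ≤ Smax' := le_max_right _ _
  have hresp : ∀ k : TorusSite 2 L, k ≠ 0 → ‖kernelFT L (insertionResponse aM aN x) k‖ ≤ B := by
    intro k hk
    have h := norm_kernelFT_insertionResponse_le aM aN (1 / 2 + M L / (L : ℝ) ^ 2)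
      (1 / 2 + (M L - 1) / (L : ℝ) ^ 2) ((L : ℝ) ^ 2 / 2 + M L) ((L : ℝ) ^ 2 / 2 + (M L - 1)) hbN hbM
      hdN hdM hρN hρM0.le hρM1 hPN hPM hPM0 x k hk
    refine h.trans ?_
    rw [hB]
    have h1 : structureFactor L aN ((L : ℝ) ^ 2 / 2 + M L) k ≤ Smax' :=
      (hSL aN (M L) (Set.mem_insert _ _) haN k hk).trans (le_max_left _ _)
    have hSMk : structureFactor L aM ((L : ℝ) ^ 2 / 2 + (M L - 1)) k ≤ Smax' :=
      (hSL aM (M L - 1) (Set.mem_insert_of_mem _ (Set.mem_singleton _)) haM k hk).trans (le_max_left _ _)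
    have hS0 : 0 ≤ structureFactor L aM ((L : ℝ) ^ 2 / 2 + (M L - 1)) k :=
      structureFactor_nonneg aM hPM0.le k
    have h1m : 0 < 1 - (1 / 2 + (M L - 1) / (L : ℝ) ^ 2) := sub_pos.mpr hρM1
    have h2 : (1 / 2 + (M L - 1) / (L : ℝ) ^ 2) * structureFactor L aM ((L : ℝ) ^ 2 / 2 + (M L - 1)) k
        / (1 - (1 / 2 + (M L - 1) / (L : ℝ) ^ 2)) ≤ Smax' / (1 - (1 + ρ) / 2) := by
      calc (1 / 2 + (M L - 1) / (L : ℝ) ^ 2) * structureFactor L aM ((L : ℝ) ^ 2 / 2 + (M L - 1)) k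
            / (1 - (1 / 2 + (M L - 1) / (L : ℝ) ^ 2))
          ≤ Smax' / (1 - (1 / 2 + (M L - 1) / (L : ℝ) ^ 2)) := by
            refine div_le_div_of_nonneg_right ?_ h1m.le
            calc (1 / 2 + (M L - 1) / (L : ℝ) ^ 2) * structureFactor L aM ((L : ℝ) ^ 2 / 2 + (M L - 1)) k
                ≤ 1 * structureFactor L aM ((L : ℝ) ^ 2 / 2 + (M L - 1)) k :=
                  mul_le_mul_of_nonneg_right hρM1.le hS0
              _ ≤ Smax' := by rw [one_mul]; exact hSMk
        _ ≤ Smax' / (1 - (1 + ρ) / 2) :=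
            div_le_div_of_nonneg_left hSmax0 h1ρ (by linarith)
    linarith
  -- KL_G bound
  have hKG := gaussianInsertionEntropy_le aM aN ((L : ℝ) ^ 2 / 2 + (M L - 1)) hPM0 x B c α hc hresp
    (hIRL aM haM)
  have hcoef : 0 ≤ B ^ 2 / (2 * c * ((L : ℝ) ^ 2 / 2 + (M L - 1))) := by positivity
  have hstep : B ^ 2 / (2 * c * ((L : ℝ) ^ 2 / 2 + (M L - 1)))
      * ∑ k ∈ Finset.univ.filter (fun k : TorusSite 2 L => k ≠ 0), (torusNorm L k) ^ (-α)
      ≤ B ^ 2 / (2 * c * (ρ / 2)) * Clat := by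
    calc B ^ 2 / (2 * c * ((L : ℝ) ^ 2 / 2 + (M L - 1)))
          * ∑ k ∈ Finset.univ.filter (fun k : TorusSite 2 L => k ≠ 0), (torusNorm L k) ^ (-α)
        ≤ B ^ 2 / (2 * c * ((L : ℝ) ^ 2 / 2 + (M L - 1))) * (Clat * (L : ℝ) ^ 2) :=
          mul_le_mul_of_nonneg_left (hClat L) hcoef
      _ = B ^ 2 / (2 * c * (1 / 2 + (M L - 1) / (L : ℝ) ^ 2)) * Clat := by
          rw [hPM]
          field_simp
      _ ≤ B ^ 2 / (2 * c * (ρ / 2)) * Clat := by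
          refine mul_le_mul_of_nonneg_right ?_ hClat0
          refine div_le_div_of_nonneg_left (by positivity) (by positivity) ?_
          exact mul_le_mul_of_nonneg_left hMloL (by positivity)
  have hG0 : 0 ≤ gaussianInsertionEntropy L aM aN ((L : ℝ) ^ 2 / 2 + (M L - 1)) x := by
    unfold gaussianInsertionEntropy
    refine Finset.sum_nonneg fun k hk => div_nonneg (sq_nonneg _) ?_
    exact mul_nonneg (by positivity) (structureFactor_nonneg aM hPM0.le k)
  have hCle : C * gaussianInsertionEntropy L aM aN ((L : ℝ) ^ 2 / 2 + (M L - 1)) x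
      ≤ Cp * gaussianInsertionEntropy L aM aN ((L : ℝ) ^ 2 / 2 + (M L - 1)) x :=
    mul_le_mul_of_nonneg_right (le_max_left _ _) hG0
  have hC0 : 0 ≤ Cp := le_max_right _ _
  nlinarith [hKG.trans hstep, hCle, hKL, hC0]

/-- **CONDITIONAL THEOREM (cycle 8 form of the target, condensation side H1′):** along a density sequence
`→ ρ ∈ (0,1)` with non-trivial reference sectors, TWIST-IR's input (uniform twist stiffness, via the
reduction `TwistStiffnessInfrared`) ∧ H1′ ∧ (S ≤ S_max) ⇒ BEC. [folklore] -/
theorem eventualCondensate_of_twistStiffness_gaussian (hT : TwistStiffnessInfrared) (Δ : ℝ) (M : ℕ → ℝ)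
    (ρ : ℝ) (hΔ : -1 < Δ) (hρ : ρ ∈ Set.Ioo (0 : ℝ) 1)
    (hlim : Tendsto (fun L : ℕ => 1 / 2 + M L / (L : ℝ) ^ 2) atTop (nhds ρ))
    (hsect : ∀ᶠ L : ℕ in atTop, ∀ [NeZero L], spinZSector (Λ := TorusSite 2 L) 1 (M L - 1) ≠ ⊥)
    (hG : GaussianInsertionComparison Δ M) (hS : UniformTwistStiffness Δ M)
    (hSmax : StructureFactorUpper Δ M) : EventualCondensate Δ M :=
  eventualCondensate_of_insertionEntropyBound Δ M ρ hρ hlim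
    (insertionEntropyBound_of_gaussianComparison Δ M ρ hρ hlim hG
      (infraredStructureBound_of_uniformTwistStiffness hT Δ M hΔ hS) hSmax)
    (uniformSiteDensity_holds Δ M) (perronSectorExists_of_ne_bot Δ M hsect)


end Summit.HubbardSuperconductivity.HubbardSuperconductivity.Theorems.AnisotropyChord.InsertionEntropy
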